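import Literature.NumberTheory.LFunctions.ConreyIwaniec2002CircleMethodDefs
import Mathlib.Analysis.Fourier.FourierTransformDeriv
import HarnessLib

/-!
# Conrey–Iwaniec (2002), §4 (4.24): the Fourier transform of a dyadic test function, `ĝ(α) ≪ X(1+|α|X)^{-2}`

B. Conrey, H. Iwaniec, *Spacing of zeros of Hecke `L`-functions and the class number problem*,
Acta Arith. 103 (2002), §4 (4.24) [held text `paper:arxiv-math_0111012`, p0012:L58–63]: for `g`
smooth, supported on `[X, 2X]`, with `x^ν|g^{(ν)}(x)| ≤ 1` (`ν = 0,1,2`) (4.23), "we derive from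
(4.23) by partial integration that `ĝ(α) = ∫g(x)e(−αx)dx ≪ X(1+|α|X)^{-2}` (4.24). Hence
`∫|ĝ(α)|dα ≪ 1`, `∫|α||ĝ(α)|²dα ≪ 1`." Registered stub S3a `stub_bump_fourier` of SKELETON S3 (cell
`landau-siegel/ls-inputs`, line `theta-circle-method`), PROVED with `c₁ = 4`:
`bumpFourierDecay_four : BumpFourierDecay 4` and `bump_fourier : ∃ c₁ > 0, BumpFourierDecay c₁`
(statement verbatim). Proof: `|ĝ(α)| ≤ ∫|g| ≤ X`, and `ĝ'' = (2πiα)²ĝ` (Mathlib `Real.fourier_deriv`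
twice) with `∫|g''| ≤ X·X^{-2}`, so `|ĝ(α)| ≤ (4π²α²X)^{-1}`; the two bounds combine to `4X(1+|α|X)^{-2}`.

## References

* [ConreyIwaniec2002] B. Conrey, H. Iwaniec, Acta Arith. 103 (2002) 259–312, arXiv:math/0111012:
  §4 (4.23)–(4.24).
-/

noncomputable section

open scoped FourierTransform
open Complex MeasureTheory Set

namespace Literature.NumberTheory.LFunctions

namespace ConreyIwaniec2002

variable {X : ℝ} {g : ℝ → ℂ}

/-- `g = 0` off `[X, 2X]` gives `tsupport g ⊆ [X, 2X]`. [folklore] -/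
private theorem tsupport_subset_Icc (hg : IsBumpOn X g) : tsupport g ⊆ Icc X (2 * X) :=
  closure_minimal (fun x hx ↦ by_contra fun h ↦ hx (hg.2.1 x h)) isClosed_Icc

/-- A dyadic test function has compact support. [folklore] -/
private theorem hasCompactSupport_bump (hg : IsBumpOn X g) : HasCompactSupport g :=
  HasCompactSupport.intro isCompact_Icc hg.2.1

/-- `g` is `C²`: `g` differentiable, `g'` differentiable, `g''` continuous. [folklore] -/
private theorem derivs_bump (hg : IsBumpOn X g) :
    Differentiable ℝ g ∧ Differentiable ℝ (deriv g) ∧ Continuous (deriv (deriv g)) := by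
  have h2 : ContDiff ℝ (1 + 1 : WithTop ℕ∞) g := by rw [one_add_one_eq_two]; exact hg.1
  rw [contDiff_succ_iff_deriv] at h2
  have h1 : ContDiff ℝ (0 + 1 : WithTop ℕ∞) (deriv g) := by rw [zero_add]; exact h2.2.2
  rw [contDiff_succ_iff_deriv] at h1
  exact ⟨h2.1, h1.1, contDiff_zero.1 h1.2.2⟩

/-- `g'' = 0` off `[X, 2X]`. [folklore] -/
private theorem deriv_deriv_eq_zero (hg : IsBumpOn X g) {x : ℝ} (hx : x ∉ Icc X (2 * X)) :
    deriv (deriv g) x = 0 := by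
  have h1 : tsupport (deriv g) ⊆ Icc X (2 * X) :=
    closure_minimal (support_deriv_subset.trans (tsupport_subset_Icc hg)) isClosed_Icc
  have h2 : x ∉ Function.support (deriv (deriv g)) := fun h ↦ hx (h1 (support_deriv_subset h))
  simpa [Function.mem_support] using h2

/-- `‖𝓕 f α‖ ≤ ∫‖f‖`. [folklore] -/
private theorem norm_fourier_le (f : ℝ → ℂ) (α : ℝ) : ‖𝓕 f α‖ ≤ ∫ v : ℝ, ‖f v‖ := by
  rw [Real.fourier_real_eq]
  refine (norm_integral_le_integral_norm _).trans (le_of_eq ?_)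
  congr 1 with v
  rw [Circle.smul_def, norm_smul, Circle.norm_coe, one_mul]

/-- `∫‖f‖ ≤ M·X` when `‖f‖ ≤ M` on `[X, 2X]` and `f = 0` off it (`X ≥ 0`). [folklore] -/
private theorem integral_norm_le_of_bump_like (hX : 0 ≤ X) {f : ℝ → ℂ} {M : ℝ}
    (hin : ∀ x ∈ Icc X (2 * X), ‖f x‖ ≤ M) (hout : ∀ x ∉ Icc X (2 * X), f x = 0) :
    ∫ v : ℝ, ‖f v‖ ≤ M * X := by
  have hle : ∀ v : ℝ, ‖f v‖ ≤ (Icc X (2 * X)).indicator (fun _ ↦ M) v := by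
    intro v
    by_cases hv : v ∈ Icc X (2 * X)
    · rw [indicator_of_mem hv]; exact hin v hv
    · rw [indicator_of_notMem hv, hout v hv, norm_zero]
  have hint : Integrable ((Icc X (2 * X)).indicator fun _ : ℝ ↦ M) volume :=
    (continuous_const.integrableOn_Icc (μ := volume)).integrable_indicator measurableSet_Icc
  calc ∫ v : ℝ, ‖f v‖ ≤ ∫ v : ℝ, (Icc X (2 * X)).indicator (fun _ ↦ M) v :=
        integral_mono_of_nonneg (Filter.Eventually.of_forall fun v ↦ norm_nonneg _) hint
          (Filter.Eventually.of_forall hle)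
    _ = M * X := by
        rw [integral_indicator_const _ measurableSet_Icc, Real.volume_real_Icc_of_le (by linarith),
          smul_eq_mul]
        ring

/-- **(4.24) with the constant `4`**: `BumpFourierDecay 4`, i.e. `|ĝ(α)| ≤ 4X(1+|α|X)^{-2}` for
`IsBumpOn X g`, `X ≥ 1/2`. [cite: ConreyIwaniec2002, §4 (4.24)] -/
theorem bumpFourierDecay_four : BumpFourierDecay 4 := by
  intro X hX g hg α
  have hX0 : 0 < X := by linarith
  obtain ⟨hd, hd1, hc2⟩ := derivs_bump hg
  have hcs : HasCompactSupport g := hasCompactSupport_bump hg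
  -- bound 1: `|ĝ| ≤ X`
  have hB1 : ‖𝓕 g α‖ ≤ X := by
    refine (norm_fourier_le g α).trans ?_
    have := integral_norm_le_of_bump_like hX0.le (f := g) (M := 1)
      (fun x _ ↦ by simpa using hg.2.2 0 (by norm_num) x) hg.2.1
    simpa using this
  -- bound 2: `4π²α²|ĝ| ≤ X⁻¹`
  have hgi : Integrable g := hd.continuous.integrable_of_hasCompactSupport hcs
  have hg'i : Integrable (deriv g) := hd1.continuous.integrable_of_hasCompactSupport hcs.deriv
  have hg''i : Integrable (deriv (deriv g)) := hc2.integrable_of_hasCompactSupport hcs.deriv.deriv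
  have hF : 𝓕 (deriv (deriv g)) α = (2 * Real.pi * I * α) ^ 2 • 𝓕 g α := by
    rw [Real.fourier_deriv hg'i hd1 hg''i]
    dsimp only
    rw [Real.fourier_deriv hgi hd hg'i]
    dsimp only
    rw [smul_smul, pow_two]
  have hI : ∫ v : ℝ, ‖deriv (deriv g) v‖ ≤ (X ^ 2)⁻¹ * X := by
    refine integral_norm_le_of_bump_like hX0.le (fun x hx ↦ ?_) (fun x hx ↦ deriv_deriv_eq_zero hg hx)
    have hx0 : 0 < x := lt_of_lt_of_le hX0 hx.1
    have h := hg.2.2 2 le_rfl x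
    rw [iteratedDeriv_succ, iteratedDeriv_one] at h
    have hx2 : X ^ 2 ≤ x ^ 2 := pow_le_pow_left₀ hX0.le hx.1 2
    calc ‖deriv (deriv g) x‖ = (x ^ 2)⁻¹ * (x ^ 2 * ‖deriv (deriv g) x‖) := by
          field_simp
      _ ≤ (x ^ 2)⁻¹ * 1 := mul_le_mul_of_nonneg_left h (by positivity)
      _ ≤ (X ^ 2)⁻¹ := by rw [mul_one]; exact inv_anti₀ (by positivity) hx2
  have hn : ‖(2 * Real.pi * I * α : ℂ)‖ = 2 * Real.pi * |α| := by
    simp [Complex.norm_real, abs_of_pos Real.pi_pos]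
  have hnorm : ‖𝓕 (deriv (deriv g)) α‖ = 4 * Real.pi ^ 2 * α ^ 2 * ‖𝓕 g α‖ := by
    rw [hF, norm_smul, norm_pow, hn, mul_pow, mul_pow, sq_abs]; ring
  have key : 4 * Real.pi ^ 2 * α ^ 2 * ‖𝓕 g α‖ ≤ X⁻¹ := by
    rw [← hnorm]
    refine (norm_fourier_le _ α).trans (hI.trans (le_of_eq ?_))
    field_simp
  -- combination
  set F := ‖𝓕 g α‖ with hFdef
  have hF0 : 0 ≤ F := norm_nonneg _
  set t := |α| * X with htdef
  have ht0 : 0 ≤ t := by positivity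
  have h2 : t ^ 2 * F ≤ X := by
    have hπ : (1 : ℝ) ≤ 4 * Real.pi ^ 2 := by nlinarith [Real.pi_gt_three]
    have hαF : α ^ 2 * F ≤ X⁻¹ := by
      have : α ^ 2 * F ≤ 4 * Real.pi ^ 2 * α ^ 2 * F := by
        have h0 : 0 ≤ α ^ 2 * F := by positivity
        nlinarith
      exact this.trans key
    calc t ^ 2 * F = X ^ 2 * (α ^ 2 * F) := by rw [htdef, mul_pow, sq_abs]; ring
      _ ≤ X ^ 2 * X⁻¹ := mul_le_mul_of_nonneg_left hαF (by positivity)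
      _ = X := by field_simp
  have h3 : 2 * t * F ≤ F + t ^ 2 * F := by nlinarith [sq_nonneg (t - 1), hF0]
  have h4 : F * (1 + t) ^ 2 ≤ 4 * X := by nlinarith
  rw [le_div_iff₀ (by positivity)]
  exact h4

/-- **S3a — (4.24)** (registered stub `stub_bump_fourier` of SKELETON S3, statement verbatim):
`∃ c₁ > 0, BumpFourierDecay c₁` (`c₁ = 4`). [cite: ConreyIwaniec2002, §4 (4.24)] -/
theorem bump_fourier : ∃ c₁ : ℝ, 0 < c₁ ∧ BumpFourierDecay c₁ :=
  ⟨4, by norm_num, bumpFourierDecay_four⟩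

end ConreyIwaniec2002

end Literature.NumberTheory.LFunctions

end
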